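import Summits.BirchSwinnertonDyer.BirchSwinnertonDyer.Theorems.ThetaPartnerAtTwoSignedKatoUpToAtTwoLocalTwoColemanKernelConverse
import Summits.BirchSwinnertonDyer.BirchSwinnertonDyer.Theorems.ThetaPartnerAtTwoSignedKatoUpToAtTwoLocalTwoSignedTransport
import Summits.BirchSwinnertonDyer.BirchSwinnertonDyer.Theorems.ThetaPartnerAtTwoSignedKatoUpToAtTwoLocalTwoSignedIntersection
import Summits.BirchSwinnertonDyer.Rank1Residual.Additive.StrictSignedSelmerInftyLocal
import Literature.NumberTheory.EllipticCurves.Sprung2012.LocalTowerLayersProofs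
import Literature.NumberTheory.EllipticCurves.Sprung2012.ColemanMapLambdaActionProofs
import Literature.Algebra.Module.PadicFunctionalSeparation
import HarnessLib

/-!
# Route `ByReductionTypeAtTwo` (rung K4), crux `SupersingularRankZeroAtTwo` (item stmt-BirchSwinnertonDyer-19097):
# **CDF IS LOCALLY TRUE AT `a₂ = 0`** — the ψ₂-descended ♭ condition is TRANSVERSE to the Kummer line:
# for every non-divisible `ψ₂`-vector `y ∈ E(ℚ₂(√2))` there is `z ∈ Ker Col♭` with `z(y) ≠ 0`
# (seat `bsd-2adic-ss-1`, GEN 18, LEAD attack (L2) on stub 5 `stub_CD` of the registered line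
# `Cruxes/SupersingularRankZeroAtTwo/Lines/odd_blind_package.lean` v2.4, the `a₂ = 0` sub-family)

HONEST FRAMING (cell `bsd-2adic`, run/shared/lean/pub/bsd-2adic/): THEOREMS ONLY; no definition, no named fact, no
`sorry`, no instance. Nothing about any Selmer group, `L`-function or census cell is asserted; nothing booked (D-0054);
BSD is not proved by any of this. PARTITION: X5@2 good-ss r₀ block, `a₂ = 0` sub-row × p = 2 — types-the-object-of (the
LOCAL half of CDF `FlatBlindControlFiniteAtTwo` at `a₂ = 0` becomes a kernel theorem); closes none. bears_on: K4 (item 19097).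

## Statement (companion of `…FlatBlindLocalTransversality.lean`, p800827)

`OddBlindLocal.exists_mem_colemanKer_flat_not_dvd_apply_of_frobeniusTrace_eq_zero`: `W/ℚ` globally minimal with
`GoodSS W 2` and `a₂(W) = 0`, `κ` the cyclotomic `ℤ₂`-extension, `v ∋ 2`, `g ∈ Γ_{ℚ_v}` a local lift of the topological
generator, `c` ANY system of local points with the line's clauses (L) `c n ∈ E(ℚ_{n,v})` and (TR)
`Tr_{n+1/n} c_{n+1} = a₂·c_n − c_{n−1}` (`n ≥ 1`) — no generation clause, no Honda relation at level `0/1` — and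
`y ∈ E(ℚ_{1,v}) = E(ℚ₂(√2))` a `ψ₂`-VECTOR (`g·y = −y`) NOT of the form `2^k·w`, `w ∈ E(ℚ_{1,v})`: **there is a functional
`z ∈ Ker Col♭` (Sprung's ♭ Coleman kernel for `(a₂, g, c) = (0, g, c)`) with `2^{k+1} ∤ z(y)`, in particular `z(y) ≠ 0`.**
Read through Def. 7.9 (`E^♭ = Ann(Ker Col♭)`): the Kummer classes `y ⊗ 2^{−j}`, `j > k`, are NOT in the ♭ local condition —
the ψ₂-part `L♭_ψ = E^♭ ∩ (E(ℚ_{∞,2}) ⊗ ℚ₂/ℤ₂)[γ+1]` meets the Kummer line `ℤ₂·y ⊗ ℚ₂/ℤ₂` of the twist in a group of order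
`≤ 2^k`.  This is the LOCAL content of CDF (`Sel♭(E/ℚ_∞)[γ+1]` finite on the odd-twist half) at `a₂ = 0`; the global half
(inflation–restriction with `E(ℚ_∞)[2] = 0`, Poitou–Tate for `E^{(2)}` relaxed/strict at `2`, which supplies `y` = the image of
the non-torsion point of `E^{(2)}(ℚ)` and its non-divisibility) is untouched here.

## Proof (Kobayashi's `±` structure at `p = 2`, all TREE THEOREMS, + Pontryagin separation)

Write `E_n = E(ℚ_{n,v})`, `E^± _n` = Def. 1.1's signed groups (`Kobayashi2003.signedLocalPointsOfEmb κ ι W (±1) n`),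
`N = E(ℚ_{∞,v}·ℚ_v)`, `B = ⋃_n E⁺_n ≤ N` (nested union, `signedLocalPointsOfEmb_mono`), `Q = N/B`.
1. **`Q` has no `2`-torsion**: if `2x ∈ E⁺_m`, pick `n ≥ m` with `x ∈ E_n = E⁺_n + E⁻_n` (Prop. 8.12 ii) GENERATION at
   `p = 2`, `a₂ = 0`: tree `SignedKatoOffTwo.LocalTwo.sup_signedLocalPoints_eq_localLayerPoints_two_adicCompletion`), `x = a + b`;
   then `2b ∈ E⁺_n ∩ E⁻_n = E(ℚ_v)` (DIRECTNESS: `SignedIntersection.signedLocalPointsOfEmb_one_inf_neg_one_eq_two_adicCompletion`),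
   so `b ∈ E(ℚ_v) ⊆ E⁺_n` (`E(ℚ_v)` is `2`-saturated in the `2`-torsion-free tower: `Sprung2012.mem_localLayerPointsOfEmb_of_pow_nsmul_mem`,
   `SignedIntersection.noTwoTorsion_localTowerPointsOfEmb_adicCompletion`) and `x ∈ E⁺_n ⊆ B`.
2. **`ȳ ∉ 2^{k+1}Q`**: if `y − 2^{k+1}x ∈ E⁺_n` with `x = a + b` as above, then `y − 2^{k+1}b ∈ E⁺_n ∩ E⁻_n = E(ℚ_v)`
   (`y ∈ E_1 ⊆ E⁻_n`, `mem_signedLocalPointsOfEmb_neg_one_of_mem_layer_one`) is FIXED by `g`; applying `1 − g` and `g·y = −y`: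
   `2y = 2^{k+1}(b − g·b)`, so `y = 2^k·w` with `w = b − g·b ∈ E_1` (no `2`-torsion; `b ∈ E_1` by saturation) — excluded.
3. Pontryagin separation on the `2`-torsion-free `Q` (`Literature.Algebra.Module.exists_addMonoidHom_padicInt_not_dvd`) gives
   `z̄ : Q → ℤ₂` with `2^{k+1} ∤ z̄(ȳ)`; `z = z̄ ∘ (N → Q)` kills every `E⁺_n`.
4. `ann(⋃ E⁺_n) ⊆ Ker Col♭` for EVERY (L)(TR)-system at `a₂ = 0` (tree, TP2 lineage:
   `SignedKatoOffTwo.ColemanConverse.mem_colemanKer_flat_of_forall_signedPlus_of_trace`; Coleman values by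
   `SSFlatEC.exists_isColemanPair_of_trace`).
In print the ingredients are Kobayashi 2003 Prop. 8.12 / Thm. 6.2 for ODD `p`; the `p = 2` versions are the tree's own theorems
(cells `bsd-wall` TP2, `bsd-2adic`). The `a₂ = ±2` analogue is NOT reachable this way (no parity vanishing of Sprung's
`u_n`, `v_n`; Open Problem 7.22) — see the Wronskian criterion of `…FlatBlindLocalTransversality.lean`.

## References
* [Kobayashi2003] S. Kobayashi, Invent. Math. 152 (2003): Def. 1.1 (p. 2), Thm. 6.2, Prop. 8.7, Prop. 8.12 ii) and (8.22) (p. 17),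
  Prop. 8.18–8.23.
* [Sprung2012] F. E. I. Sprung, J. Number Theory 132 (2012): Thm. 2.2 (2′), Lemma 2.3, Def. 5.9, Def. 7.9, Lemma 7.10, p. 1485
  (`Col♭ = Col⁺` at `a_p = 0`).
* [NeukirchSchmidtWingberg2008] I §1 (1.1.8) (Pontryagin duality).
-/

set_option autoImplicit false
set_option linter.dupNamespace false

noncomputable section

open scoped Classical NumberField

universe u

namespace Summit.BirchSwinnertonDyer.BirchSwinnertonDyer.Theorems

namespace OddBlindLocal

open NumberField IsDedekindDomain Literature.NumberTheory.EllipticCurves Literature.NumberTheory.GaloisRepresentations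
  ZpExtension Literature.NumberTheory.EllipticCurves.Kobayashi2003 Literature.NumberTheory.EllipticCurves.Sprung2017
  Literature.NumberTheory.EllipticCurves.Sprung2012 Literature.NumberTheory.EllipticCurves.Rank1Residual
  Summit.BirchSwinnertonDyer.Rank1Residual.Additive

/-! ## §1 Two small facts about Def. 1.1's groups (any base, `p = 2`) -/

section Generic

variable {K : Type u} [Field K] (κ : ZpExtension K 2)
variable {E : Type u} [Field E] [Algebra K E] (ι : AlgebraicClosure K →ₐ[K] AlgebraicClosure E)
variable (W : WeierstrassCurve K)

/-- **`E(K_1·K_v) ≤ E⁻(K_n·K_v)` for `n ≥ 1`**: on a point of layer `1` every trace `Tr_{n/m+1}` with `m` ODD (so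
`m + 1 ≥ 2 > 1`) is multiplication by an index, which stays in `E(K_1·K_v) ≤ E(K_m·K_v)`. (Kobayashi: `E⁻(F_{1,p}) =
E(F_{1,p})`; the first layer is «minus».) [cite: Kobayashi2003, Def. 1.1 (p. 2)] -/
theorem mem_signedLocalPointsOfEmb_neg_one_of_mem_layer_one {y : localPoints W E}
    (hy : y ∈ localLayerPointsOfEmb κ ι W 1) {n : ℕ} (hn : 1 ≤ n) :
    y ∈ signedLocalPointsOfEmb κ ι W (-1) n := by
  refine ⟨localLayerPointsOfEmb_mono κ ι W hn hy, fun m _ hodd ↦ ?_⟩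
  have hm : 1 ≤ m := by
    rcases Nat.eq_zero_or_pos m with rfl | hm
    · rw [Nat.cast_zero, Int.negOnePow_zero] at hodd
      exact absurd hodd (by decide)
    · exact hm
  have hym1 : y ∈ localLayerPointsOfEmb κ ι W (m + 1) := localLayerPointsOfEmb_mono κ ι W (by omega) hy
  rw [localTraceOfEmb_apply_of_mem_lower κ ι W (m + 1) n hym1]
  exact AddSubgroup.nsmul_mem _ (localLayerPointsOfEmb_mono κ ι W hm hy) _

/-- Points of `E(K_0·K_v) = E(K_v)` are fixed by every `τ ∈ Γ_{K_v}` (unfolding). [cite: Kobayashi2003, Def. 1.1 (p. 2)] -/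
theorem smul_eq_self_of_mem_layer_zero {P : localPoints W E} (hP : P ∈ localLayerPointsOfEmb κ ι W 0)
    (τ : Field.absoluteGaloisGroup E) : τ • P = P :=
  (mem_localLayerPointsOfEmb_zero_iff κ ι W P).mp hP τ

/-! ## §2 The functional: vanishing on every `E⁺(K_n·K_v)`, `2^{k+1} ∤ z(y)` (any base, `p = 2`, under (NT)(SUM)(INT)) -/

variable {κ ι W}

/-- **THE SEPARATING FUNCTIONAL** (generic form).  Hypotheses on the local tower at `p = 2`: (NT) `E(K_∞·K_v)` has no
`2`-torsion; (SUM) `E⁺_n + E⁻_n = E_n` and (INT) `E⁺_n ∩ E⁻_n = E_0` for every `n` (Kobayashi's (8.22)).  Then for every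
`ψ₂`-vector `y ∈ E(K_1·K_v)` (`g·y = −y` for some `g ∈ Γ_{K_v}`) with `y ∉ 2^k·E(K_1·K_v)` there is an additive
`z : E(K_∞·K_v) → ℤ₂` vanishing on every `E⁺(K_n·K_v)` with `2^{k+1} ∤ z(y)`.  Proof = module docstring steps 1–3
(`Q = N/⋃E⁺_n` is `2`-torsion-free; `ȳ ∉ 2^{k+1}Q` by applying `1 − g`; Pontryagin separation).
[cite: Kobayashi2003, Prop. 8.12 ii) and (8.22) (p. 17)] [cite: NeukirchSchmidtWingberg2008, I §1 (1.1.8)] -/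
theorem exists_addMonoidHom_forall_signedPlus_eq_zero_not_dvd_apply
    (hnt : ∀ P ∈ localTowerPointsOfEmb κ ι W, 2 • P = 0 → P = 0)
    (hsum : ∀ n, signedLocalPointsOfEmb κ ι W 1 n ⊔ signedLocalPointsOfEmb κ ι W (-1) n = localLayerPointsOfEmb κ ι W n)
    (hint : ∀ n, signedLocalPointsOfEmb κ ι W 1 n ⊓ signedLocalPointsOfEmb κ ι W (-1) n = localLayerPointsOfEmb κ ι W 0)
    {g : Field.absoluteGaloisGroup E} {y : localPoints W E} (hy : y ∈ localLayerPointsOfEmb κ ι W 1)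
    (hgy : g • y = -y) {k : ℕ} (hndiv : ∀ w ∈ localLayerPointsOfEmb κ ι W 1, 2 ^ k • w ≠ y) :
    ∃ z : localTowerPointsOfEmb κ ι W →+ ℤ_[2],
      (∀ (n : ℕ) (x : localPoints W E) (hx : x ∈ signedLocalPointsOfEmb κ ι W 1 n),
        z ⟨x, localLayerPointsOfEmb_le_localTowerPointsOfEmb κ ι W n (signedLocalPointsOfEmb_le κ ι W 1 n hx)⟩ = 0) ∧
      ¬ (2 : ℤ_[2]) ^ (k + 1) ∣ z ⟨y, localLayerPointsOfEmb_le_localTowerPointsOfEmb κ ι W 1 hy⟩ := by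
  -- abbreviations
  set N : AddSubgroup (localPoints W E) := localTowerPointsOfEmb κ ι W with hN
  have hle : ∀ n, localLayerPointsOfEmb κ ι W n ≤ N := fun n ↦ localLayerPointsOfEmb_le_localTowerPointsOfEmb κ ι W n
  have hyN : y ∈ N := hle 1 hy
  -- `B = ⋃ₙ E⁺_n` pulled back to `↥N`, and the quotient `Q = N/B`
  let B : AddSubgroup N := (⨆ n, signedLocalPointsOfEmb κ ι W 1 n).comap N.subtype
  have hdir : Directed (· ≤ ·) (fun n ↦ signedLocalPointsOfEmb κ ι W 1 n) :=
    (signedLocalPointsOfEmb_mono κ ι W 1).directed_le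
  have hmemB : ∀ x : N, x ∈ B ↔ ∃ m, (x : localPoints W E) ∈ signedLocalPointsOfEmb κ ι W 1 m := by
    intro x
    rw [AddSubgroup.mem_comap, AddSubgroup.coe_subtype]
    exact AddSubgroup.mem_iSup_of_directed hdir
  -- the decomposition at a high layer
  have hdec : ∀ (n : ℕ) (x : localPoints W E), x ∈ localLayerPointsOfEmb κ ι W n →
      ∃ a ∈ signedLocalPointsOfEmb κ ι W 1 n, ∃ b ∈ signedLocalPointsOfEmb κ ι W (-1) n, a + b = x := by
    intro n x hx
    rw [← hsum n] at hx
    exact AddSubgroup.mem_sup.mp hx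
  -- membership in `E⁺ ∩ E⁻` is membership in layer `0`
  have hinter : ∀ (n : ℕ) (f : localPoints W E), f ∈ signedLocalPointsOfEmb κ ι W 1 n →
      f ∈ signedLocalPointsOfEmb κ ι W (-1) n → f ∈ localLayerPointsOfEmb κ ι W 0 := by
    intro n f h1 h2
    have h := AddSubgroup.mem_inf.mpr ⟨h1, h2⟩
    rwa [hint n] at h
  -- Step 1: `Q` has no `2`-torsion
  have hQ : ∀ q : N ⧸ B, 2 • q = 0 → q = 0 := by
    intro q
    induction q using QuotientAddGroup.induction_on with
    | H x =>
      intro h2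
      rw [← QuotientAddGroup.mk_nsmul, QuotientAddGroup.eq_zero_iff, hmemB] at h2
      obtain ⟨m, hm⟩ := h2
      rw [AddSubgroupClass.coe_nsmul] at hm
      obtain ⟨n₀, hn₀⟩ := exists_mem_localLayerPointsOfEmb_of_mem_localTowerPointsOfEmb κ ι W x.2
      set n := m + n₀ + 1 with hn_def
      have hxn : (x : localPoints W E) ∈ localLayerPointsOfEmb κ ι W n :=
        localLayerPointsOfEmb_mono κ ι W (by omega) hn₀
      have h2xn : 2 • (x : localPoints W E) ∈ signedLocalPointsOfEmb κ ι W 1 n :=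
        signedLocalPointsOfEmb_mono κ ι W 1 (by omega : m ≤ n) hm
      obtain ⟨a, ha, b, hb, hab⟩ := hdec n x hxn
      have h2b : 2 • b ∈ signedLocalPointsOfEmb κ ι W 1 n := by
        have e : 2 • b = 2 • (x : localPoints W E) - 2 • a := by rw [← hab, smul_add]; abel
        rw [e]
        exact sub_mem h2xn (AddSubgroup.nsmul_mem _ ha 2)
      have hb0 : b ∈ localLayerPointsOfEmb κ ι W 0 := by
        have h2b0 := hinter n (2 • b) h2b (AddSubgroup.nsmul_mem _ hb 2)
        exact mem_localLayerPointsOfEmb_of_pow_nsmul_mem κ ι W hnt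
          (hle n (signedLocalPointsOfEmb_le κ ι W (-1) n hb)) (k := 1) (by rwa [pow_one])
      have hxB : (x : localPoints W E) ∈ signedLocalPointsOfEmb κ ι W 1 n := by
        rw [← hab]
        exact add_mem ha (localLayerPointsOfEmb_zero_le_signedLocalPointsOfEmb κ ι W 1 n hb0)
      exact (QuotientAddGroup.eq_zero_iff x).mpr ((hmemB x).mpr ⟨n, hxB⟩)
  -- Step 2: `ȳ ∉ 2^{k+1} Q`
  have hndivQ : ∀ q : N ⧸ B, 2 ^ (k + 1) • q ≠ QuotientAddGroup.mk ⟨y, hyN⟩ := by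
    intro q
    induction q using QuotientAddGroup.induction_on with
    | H x =>
      intro h
      rw [← QuotientAddGroup.mk_nsmul, QuotientAddGroup.eq_iff_sub_mem, hmemB] at h
      obtain ⟨m, hm⟩ := h
      rw [AddSubgroupClass.coe_sub, AddSubgroupClass.coe_nsmul] at hm
      -- work at a layer `n ≥ 1` containing `x` and above `m`
      obtain ⟨n₀, hn₀⟩ := exists_mem_localLayerPointsOfEmb_of_mem_localTowerPointsOfEmb κ ι W x.2
      set n := m + n₀ + 1 with hn_def
      have hxn : (x : localPoints W E) ∈ localLayerPointsOfEmb κ ι W n :=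
        localLayerPointsOfEmb_mono κ ι W (by omega) hn₀
      have hen : 2 ^ (k + 1) • (x : localPoints W E) - y ∈ signedLocalPointsOfEmb κ ι W 1 n :=
        signedLocalPointsOfEmb_mono κ ι W 1 (by omega : m ≤ n) hm
      have hyminus : y ∈ signedLocalPointsOfEmb κ ι W (-1) n :=
        mem_signedLocalPointsOfEmb_neg_one_of_mem_layer_one κ ι W hy (by omega)
      obtain ⟨a, ha, b, hb, hab⟩ := hdec n x hxn
      -- `f := y − 2^{k+1} b ∈ E⁺_n ∩ E⁻_n = E_0`
      have hfplus : y - 2 ^ (k + 1) • b ∈ signedLocalPointsOfEmb κ ι W 1 n := by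
        have e : y - 2 ^ (k + 1) • b = 2 ^ (k + 1) • a - (2 ^ (k + 1) • (x : localPoints W E) - y) := by
          rw [← hab, smul_add]; abel
        rw [e]
        exact sub_mem (AddSubgroup.nsmul_mem _ ha _) hen
      have hfminus : y - 2 ^ (k + 1) • b ∈ signedLocalPointsOfEmb κ ι W (-1) n :=
        sub_mem hyminus (AddSubgroup.nsmul_mem _ hb _)
      have hf0 : y - 2 ^ (k + 1) • b ∈ localLayerPointsOfEmb κ ι W 0 := hinter n _ hfplus hfminus
      -- apply `1 − g`
      have hgf : g • (y - 2 ^ (k + 1) • b) = y - 2 ^ (k + 1) • b := smul_eq_self_of_mem_layer_zero κ ι W hf0 g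
      rw [smul_sub, hgy, smul_comm] at hgf
      -- so `2 • y = 2^{k+1} • (b − g • b)`
      have h2y : 2 • (y - 2 ^ k • (b - g • b)) = 0 := by
        have e1 : y + y = 2 ^ (k + 1) • b - 2 ^ (k + 1) • (g • b) := by
          have := hgf
          -- `-y - 2^{k+1} • g•b = y - 2^{k+1} • b`
          rw [sub_eq_sub_iff_add_eq_add] at this
          -- this : -y + 2^{k+1} • b = y + 2^{k+1} • (g • b)
          have e2 : y + y = (-y + 2 ^ (k + 1) • b) + y - 2 ^ (k + 1) • (g • b) + 0 := by
            rw [this]; abel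
          rw [e2]; abel
        simp only [smul_sub, smul_smul, ← pow_succ']
        rw [two_nsmul, e1, sub_self]
      have hbN : b ∈ N := hle n (signedLocalPointsOfEmb_le κ ι W (-1) n hb)
      have hgbN : g • b ∈ N := smul_mem_localTowerPointsOfEmb κ ι W g hbN
      have hwN : y - 2 ^ k • (b - g • b) ∈ N := sub_mem hyN (AddSubgroup.nsmul_mem _ (sub_mem hbN hgbN) _)
      have hyw : y = 2 ^ k • (b - g • b) :=
        sub_eq_zero.mp (hnt _ hwN h2y)
      -- `b ∈ E_1` by saturation (`2^{k+1} b = y − f ∈ E_1`), hence `w = b − g•b ∈ E_1`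
      have h2b1 : 2 ^ (k + 1) • b ∈ localLayerPointsOfEmb κ ι W 1 := by
        have e : 2 ^ (k + 1) • b = y - (y - 2 ^ (k + 1) • b) := by abel
        rw [e]
        exact sub_mem hy (localLayerPointsOfEmb_mono κ ι W (Nat.zero_le 1) hf0)
      have hb1 : b ∈ localLayerPointsOfEmb κ ι W 1 := mem_localLayerPointsOfEmb_of_pow_nsmul_mem κ ι W hnt hbN h2b1
      have hw1 : b - g • b ∈ localLayerPointsOfEmb κ ι W 1 :=
        sub_mem hb1 (smul_mem_localLayerPointsOfEmb κ ι W 1 g hb1)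
      exact hndiv _ hw1 hyw.symm
  -- Step 3: Pontryagin separation on `Q`
  obtain ⟨zbar, hzbar⟩ :=
    Literature.Algebra.Module.exists_addMonoidHom_padicInt_not_dvd (p := 2) hQ (k := k + 1)
      (n := QuotientAddGroup.mk ⟨y, hyN⟩) hndivQ
  refine ⟨zbar.comp (QuotientAddGroup.mk' B), fun n x hx ↦ ?_, ?_⟩
  · have hxB : (⟨x, hle n (signedLocalPointsOfEmb_le κ ι W 1 n hx)⟩ : N) ∈ B := (hmemB _).mpr ⟨n, hx⟩
    rw [AddMonoidHom.comp_apply, QuotientAddGroup.mk'_apply, (QuotientAddGroup.eq_zero_iff _).mpr hxB, map_zero]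
  · rw [AddMonoidHom.comp_apply, QuotientAddGroup.mk'_apply]
    exact_mod_cast hzbar

end Generic

/-! ## §3 Over `ℚ` at `v ∋ 2`: CDF's local transversality at `a₂ = 0` for the registered line's binders -/

section Rat

variable (W : WeierstrassCurve ℚ) [W.IsElliptic] [W.IsGloballyMinimal]

/-- ★★★ **LOCAL TRANSVERSALITY OF THE ♭ CONDITION AT `ψ₂`, `a₂ = 0`** (the `a₂ = 0` sub-family of CDF
`FlatBlindControlFiniteAtTwo`, local half).  `W/ℚ` globally minimal, `GoodSS W 2`, `a₂(W) = 0`, `κ` cyclotomic, `v ∋ 2`, `g` a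
local lift of the topological generator, `c` ANY local system with the line's clauses (L) and (TR) (stub 2 / K67 binders
verbatim: `c n ∈ E(ℚ_{n,v})`, `Tr_{n+1/n} c_{n+1} = a₂·c_n − c_{n−1}` for `n ≥ 1`), `y ∈ E(ℚ_{1,v})` with `g·y = −y` and
`y ∉ 2^k·E(ℚ_{1,v})`: **some `z ∈ Ker Col♭` has `2^{k+1} ∤ z(y)`** — the Kummer classes `y ⊗ 2^{−j}`, `j > k`, lie outside
Sprung's `E^♭ = Ann(Ker Col♭)`.  Assembly of §2 with the tree's `p = 2` theorems: (NT) `SignedIntersection.noTwoTorsion_…`,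
(SUM) `LocalTwo.sup_signedLocalPoints_eq_localLayerPoints_two_adicCompletion` (needs `a₂ = 0`), (INT)
`SignedIntersection.signedLocalPointsOfEmb_one_inf_neg_one_eq_two_adicCompletion`, and `ann(⋃E⁺_n) ⊆ Ker Col♭`
(`ColemanConverse.mem_colemanKer_flat_of_forall_signedPlus_of_trace`).  NOT in print at `p = 2` (Kobayashi 2003 is `p` odd);
every input is a kernel theorem of the tree. [cite: Kobayashi2003, Thm. 6.2, Prop. 8.12 ii), (8.22) (p. 17)]
[cite: Sprung2012, Def. 7.9 (p. 1503), p. 1485 (Col♭ = Col⁺ at a_p = 0)] -/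
theorem exists_mem_colemanKer_flat_not_dvd_apply_of_frobeniusTrace_eq_zero (hss : GoodSS W 2)
    (ha : W.frobeniusTrace 2 = 0) {κ : ZpExtension ℚ 2} (hκ : κ.IsCyclotomic)
    (v : HeightOneSpectrum (𝓞 ℚ)) (hv : (2 : 𝓞 ℚ) ∈ v.asIdeal)
    {g : Field.absoluteGaloisGroup (v.adicCompletion ℚ)}
    (hg : κ.IsTopGenerator (resGalOfEmb (closureEmb (K := ℚ) (v.adicCompletion ℚ)) g))
    {c : ℕ → localPoints W (v.adicCompletion ℚ)}
    (hc : ∀ n, c n ∈ localLayerPointsOfEmb κ (closureEmb (K := ℚ) (v.adicCompletion ℚ)) W n)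
    (htr : ∀ n, 1 ≤ n → localTraceOfEmb κ (closureEmb (K := ℚ) (v.adicCompletion ℚ)) W n (n + 1)
      (c (n + 1)) = W.frobeniusTrace 2 • c n - c (n - 1))
    {y : localPoints W (v.adicCompletion ℚ)}
    (hy : y ∈ localLayerPointsOfEmb κ (closureEmb (K := ℚ) (v.adicCompletion ℚ)) W 1) (hgy : g • y = -y)
    {k : ℕ} (hndiv : ∀ w ∈ localLayerPointsOfEmb κ (closureEmb (K := ℚ) (v.adicCompletion ℚ)) W 1, 2 ^ k • w ≠ y) :
    ∃ z ∈ colemanKer κ (closureEmb (K := ℚ) (v.adicCompletion ℚ)) W (W.frobeniusTrace 2) g c .flat,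
      ¬ (2 : ℤ_[2]) ^ (k + 1) ∣
        z ⟨y, localLayerPointsOfEmb_le_localTowerPointsOfEmb κ (closureEmb (K := ℚ) (v.adicCompletion ℚ)) W 1 hy⟩ := by
  set ι := closureEmb (K := ℚ) (v.adicCompletion ℚ) with hι
  obtain ⟨z, hz0, hzy⟩ := exists_addMonoidHom_forall_signedPlus_eq_zero_not_dvd_apply
    (SignedKatoOffTwo.SignedIntersection.noTwoTorsion_localTowerPointsOfEmb_adicCompletion W hss κ v hv ι)
    (fun n ↦ SignedKatoOffTwo.LocalTwo.sup_signedLocalPoints_eq_localLayerPoints_two_adicCompletion W hss ha hκ v hv n)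
    (fun n ↦ SignedKatoOffTwo.SignedIntersection.signedLocalPointsOfEmb_one_inf_neg_one_eq_two_adicCompletion
      W hss κ v hv ι n)
    hy hgy hndiv
  refine ⟨z, ?_, hzy⟩
  have htr' : ∀ m, localTraceOfEmb κ ι W (m + 1) (m + 2) (c (m + 2)) = -c m := by
    intro m
    have h := htr (m + 1) (by omega)
    rw [ha, zero_zsmul, zero_sub, Nat.add_sub_cancel] at h
    exact h
  rw [ha]
  exact SignedKatoOffTwo.ColemanConverse.mem_colemanKer_flat_of_forall_signedPlus_of_trace hg hc htr' hz0

/-- **Hence `z(y) ≠ 0` for some `z ∈ Ker Col♭`** — `Ker Col♭ ⊄ Ann(y)`: in the language of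
`…FlatBlindLocalTransversality.lean`, the ♭ line at `ψ₂` is NOT the Kummer line through `y` (transversality `t = 0` holds
locally at `a₂ = 0`, with the defect group killed by `2^k`). [cite: Kobayashi2003, Prop. 8.12 ii) (p. 17)]
[cite: Sprung2012, Def. 7.9 (p. 1503)] -/
theorem exists_mem_colemanKer_flat_apply_ne_zero_of_frobeniusTrace_eq_zero (hss : GoodSS W 2)
    (ha : W.frobeniusTrace 2 = 0) {κ : ZpExtension ℚ 2} (hκ : κ.IsCyclotomic)
    (v : HeightOneSpectrum (𝓞 ℚ)) (hv : (2 : 𝓞 ℚ) ∈ v.asIdeal)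
    {g : Field.absoluteGaloisGroup (v.adicCompletion ℚ)}
    (hg : κ.IsTopGenerator (resGalOfEmb (closureEmb (K := ℚ) (v.adicCompletion ℚ)) g))
    {c : ℕ → localPoints W (v.adicCompletion ℚ)}
    (hc : ∀ n, c n ∈ localLayerPointsOfEmb κ (closureEmb (K := ℚ) (v.adicCompletion ℚ)) W n)
    (htr : ∀ n, 1 ≤ n → localTraceOfEmb κ (closureEmb (K := ℚ) (v.adicCompletion ℚ)) W n (n + 1)
      (c (n + 1)) = W.frobeniusTrace 2 • c n - c (n - 1))
    {y : localPoints W (v.adicCompletion ℚ)}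
    (hy : y ∈ localLayerPointsOfEmb κ (closureEmb (K := ℚ) (v.adicCompletion ℚ)) W 1) (hgy : g • y = -y)
    {k : ℕ} (hndiv : ∀ w ∈ localLayerPointsOfEmb κ (closureEmb (K := ℚ) (v.adicCompletion ℚ)) W 1, 2 ^ k • w ≠ y) :
    ∃ z ∈ colemanKer κ (closureEmb (K := ℚ) (v.adicCompletion ℚ)) W (W.frobeniusTrace 2) g c .flat,
      z ⟨y, localLayerPointsOfEmb_le_localTowerPointsOfEmb κ (closureEmb (K := ℚ) (v.adicCompletion ℚ)) W 1 hy⟩ ≠ 0 := by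
  obtain ⟨z, hz, hzy⟩ := exists_mem_colemanKer_flat_not_dvd_apply_of_frobeniusTrace_eq_zero W hss ha hκ v hv hg hc htr
    hy hgy hndiv
  exact ⟨z, hz, fun h0 ↦ hzy (by rw [h0]; exact dvd_zero _)⟩

end Rat

end OddBlindLocal

end Summit.BirchSwinnertonDyer.BirchSwinnertonDyer.Theorems

end
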